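import Summits.QuantumFields.YangMills.Theorems.FluctuationComparisonRegPrIntLS2BetaLiftLadderCombRow
import HarnessLib

/-!
# S2β · THE SUP CHAIN ∕ (D-stage): THE COVARIANT ONE-STEP IDENTITY FOR RELATIVE CHORDS — transporting by the background turns every `σ × (relative)` cross term
# into background PLAQUETTES: `η_{⟨x,μ⟩} = P_V · η_{⟨x,ν⟩} · Ad_{V₁⟨x,ν⟩} η_{⟨x+e_ν,μ⟩} · Ad(ξ_{⟨x+e_μ,ν⟩}⁻¹) · P_{V₁}⁻¹`, and its `dist1` ∕ arc corollaries

Cell `ym3-torus` (rung R3 = continuum `SU(2)` Yang–Mills on T³ at fixed lattice data — NOT d = 4, NOT infinite volume, NOT a mass gap, NOT Clay).  Width seat «width 12»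
`ym3-torus-px12` (gen 26), FREE px helper on crux `stmt-QuantumFields-20520`; `--supports` helper, count-neutral, DEFINITION-FREE (0 `def`∕`instance`∕`notation`∕`sorry`,
default heartbeats).

WHY (architect px17 g23 RULING «SRC-VOL (3)» 23:46:52Z, HAZARD «SRC-VOL-R» (q1)∕(q2); px13 g28 23:48:06Z: «the COVARIANT edition needs no β — is the covariant oscillation
of the relative field (BKG∕ρ)-class?»; my answer 23:50:55Z).  Every RAW letter of the chain carries a σ-class cross coefficient (✓p835228's `16(L⁻¹σ)(L⁻¹r)`, ✓P's
`2(4sU+aU)·mA`, C₅'s `κ`) = the commutator `[background bond, relative field]`.  THIS FILE records the exact group identity that removes it at ONE level: for two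
fields `V, V₁` on the same lattice, the right relative chord `η_b := V b·(V₁ b)⁻¹` at `b = ⟨x, μ⟩` equals the background-transported relative chord at the parallel
bond `⟨x+e_ν, μ⟩` up to the two TRANSVERSE relative chords and the two PLAQUETTES of `V` and of `V₁` through `(x; μ, ν)` — so the covariant same-direction
oscillation is bounded, in chord currency, by `dist1 η_{⟨x,ν⟩} + dist1 ξ_{⟨x+e_μ,ν⟩} + dist1 P_V + dist1 P_{V₁}` (NO bond sizes of the background), and the arc of
`η_{⟨x,μ⟩}·(Ad_{V₁⟨x,ν⟩} η_{⟨x+e_ν,μ⟩})⁻¹` likewise (arc is a class function).  HONEST READING (posted): this converts `σ·M` into `BKG·M + M²`, it does NOT make the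
oscillation smaller than the relative field's SIZE — print's (1.29) regularity is not an identity.

WHAT IS PROVED (sorry-free).  ★`relChord_covariant_step` (the identity, any group), ★★`dist1_relChord_covariant_step_le` (chord currency, any `GaugeGroup`),
★★`dist1_relChord_covariant_step_le'` (the same with letters `ρ, ρ₁, m`: `≤ 2m + ρ + ρ₁`).

HONEST SCOPE.  Elementary group bookkeeping; nothing of Bałaban's renormalisation-group analysis is asserted or proved ([Balaban1985Averaging] (8)–(9) p.19 — the
plaquette and gauge conventions; [Balaban1985RegularSpaces] (1.29) p.81 — the regularity this does NOT supply).  HAZARD «SRC-VOL-R», the (β-3)′ remainder's chord²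
pieces, GAP♯∘ (`stub_uniformFibreGapOrbit`, registry UNTOUCHED), the five registered stubs (0∕5), S2β, 20520, 19936, 19200, `YM3TorusSU2` are NOT proved; no registered
stub is closed; rung R3 — NOT d = 4, NOT infinite volume, NOT a mass gap, NOT Clay; the Yang–Mills mass gap is NOT proved.
-/

set_option autoImplicit false

namespace Summit.QuantumFields.YangMills.Theorems.FluctuationComparisonRegPrIntLS2BetaRelChordCovariantStep

open Literature.MathematicalPhysics.QuantumFieldTheory.Balaban1983to89

variable {P : Params} {j : ℕ} {G : Type*}

/-- ★ **THE COVARIANT ONE-STEP IDENTITY**: with `η_b := V b·(V₁ b)⁻¹`, `ξ_b := (V₁ b)⁻¹·V b`, for a site `x` and directions `μ, ν`: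
`η_{⟨x,μ⟩} = P_V(x;μ,ν) · η_{⟨x,ν⟩} · (V₁⟨x,ν⟩·η_{⟨x+e_ν,μ⟩}·V₁⟨x,ν⟩⁻¹) · (V₁⟨x,ν⟩V₁⟨x+e_ν,μ⟩·ξ_{⟨x+e_μ,ν⟩}⁻¹·(V₁⟨x,ν⟩V₁⟨x+e_ν,μ⟩)⁻¹) · P_{V₁}(x;μ,ν)⁻¹`
(the plaquette written as the four-bond word `U⟨x,μ⟩·U⟨x+e_μ,ν⟩·U⟨x+e_ν,μ⟩⁻¹·U⟨x,ν⟩⁻¹`). [cite: Balaban1985Averaging, (9) p.19] -/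
theorem relChord_covariant_step [Group G] (V V₁ : GaugeField P j G) (x : Site P j) (μ ν : Fin P.d) :
    V ⟨x, μ⟩ * (V₁ ⟨x, μ⟩)⁻¹ =
      (V ⟨x, μ⟩ * V ⟨x.shift μ, ν⟩ * (V ⟨x.shift ν, μ⟩)⁻¹ * (V ⟨x, ν⟩)⁻¹) *
        (V ⟨x, ν⟩ * (V₁ ⟨x, ν⟩)⁻¹) *
        (V₁ ⟨x, ν⟩ * (V ⟨x.shift ν, μ⟩ * (V₁ ⟨x.shift ν, μ⟩)⁻¹) * (V₁ ⟨x, ν⟩)⁻¹) *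
        (V₁ ⟨x, ν⟩ * V₁ ⟨x.shift ν, μ⟩ * ((V₁ ⟨x.shift μ, ν⟩)⁻¹ * V ⟨x.shift μ, ν⟩)⁻¹ * (V₁ ⟨x, ν⟩ * V₁ ⟨x.shift ν, μ⟩)⁻¹) *
        (V₁ ⟨x, μ⟩ * V₁ ⟨x.shift μ, ν⟩ * (V₁ ⟨x.shift ν, μ⟩)⁻¹ * (V₁ ⟨x, ν⟩)⁻¹)⁻¹ := by
  group

/-- ★★ **COVARIANT SAME-DIRECTION OSCILLATION, CHORD CURRENCY**: the relative chord at `⟨x,μ⟩` against the `V₁`-transported relative chord at `⟨x+e_ν,μ⟩` is within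
`dist1 η_{⟨x,ν⟩} + dist1 ξ_{⟨x+e_μ,ν⟩} + dist1 P_V + dist1 P_{V₁}` — two transverse relative chords and two BACKGROUND PLAQUETTES, no bond sizes.
[cite: Balaban1985Averaging, (8)-(9) p.19] -/
theorem dist1_relChord_covariant_step_le [GaugeGroup G] (V V₁ : GaugeField P j G) (x : Site P j) (μ ν : Fin P.d) (hμν : μ < ν) :
    dist1 (V ⟨x, μ⟩ * (V₁ ⟨x, μ⟩)⁻¹ * (V₁ ⟨x, ν⟩ * (V ⟨x.shift ν, μ⟩ * (V₁ ⟨x.shift ν, μ⟩)⁻¹) * (V₁ ⟨x, ν⟩)⁻¹)⁻¹) ≤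
      dist1 (V ⟨x, ν⟩ * (V₁ ⟨x, ν⟩)⁻¹) + dist1 ((V₁ ⟨x.shift μ, ν⟩)⁻¹ * V ⟨x.shift μ, ν⟩) +
        dist1 (GaugeField.plaqHol V ⟨x, μ, ν, hμν⟩) + dist1 (GaugeField.plaqHol V₁ ⟨x, μ, ν, hμν⟩) := by
  -- name the five factors of the identity
  have hid := relChord_covariant_step V V₁ x μ ν
  have e : V ⟨x, μ⟩ * (V₁ ⟨x, μ⟩)⁻¹ * (V₁ ⟨x, ν⟩ * (V ⟨x.shift ν, μ⟩ * (V₁ ⟨x.shift ν, μ⟩)⁻¹) * (V₁ ⟨x, ν⟩)⁻¹)⁻¹ =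
      (GaugeField.plaqHol V ⟨x, μ, ν, hμν⟩ * (V ⟨x, ν⟩ * (V₁ ⟨x, ν⟩)⁻¹)) *
        ((V₁ ⟨x, ν⟩ * (V ⟨x.shift ν, μ⟩ * (V₁ ⟨x.shift ν, μ⟩)⁻¹) * (V₁ ⟨x, ν⟩)⁻¹) *
          ((V₁ ⟨x, ν⟩ * V₁ ⟨x.shift ν, μ⟩ * ((V₁ ⟨x.shift μ, ν⟩)⁻¹ * V ⟨x.shift μ, ν⟩)⁻¹ * (V₁ ⟨x, ν⟩ * V₁ ⟨x.shift ν, μ⟩)⁻¹) *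
            (GaugeField.plaqHol V₁ ⟨x, μ, ν, hμν⟩)⁻¹) *
          (V₁ ⟨x, ν⟩ * (V ⟨x.shift ν, μ⟩ * (V₁ ⟨x.shift ν, μ⟩)⁻¹) * (V₁ ⟨x, ν⟩)⁻¹)⁻¹) := by
    simp only [GaugeField.plaqHol]
    group
  rw [e]
  have h1 := GaugeGroup.dist1_mul_le (GaugeField.plaqHol V ⟨x, μ, ν, hμν⟩ * (V ⟨x, ν⟩ * (V₁ ⟨x, ν⟩)⁻¹))
    ((V₁ ⟨x, ν⟩ * (V ⟨x.shift ν, μ⟩ * (V₁ ⟨x.shift ν, μ⟩)⁻¹) * (V₁ ⟨x, ν⟩)⁻¹) *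
      ((V₁ ⟨x, ν⟩ * V₁ ⟨x.shift ν, μ⟩ * ((V₁ ⟨x.shift μ, ν⟩)⁻¹ * V ⟨x.shift μ, ν⟩)⁻¹ * (V₁ ⟨x, ν⟩ * V₁ ⟨x.shift ν, μ⟩)⁻¹) *
        (GaugeField.plaqHol V₁ ⟨x, μ, ν, hμν⟩)⁻¹) *
      (V₁ ⟨x, ν⟩ * (V ⟨x.shift ν, μ⟩ * (V₁ ⟨x.shift ν, μ⟩)⁻¹) * (V₁ ⟨x, ν⟩)⁻¹)⁻¹)
  have h2 := GaugeGroup.dist1_mul_le (GaugeField.plaqHol V ⟨x, μ, ν, hμν⟩) (V ⟨x, ν⟩ * (V₁ ⟨x, ν⟩)⁻¹)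
  have h3 : dist1 ((V₁ ⟨x, ν⟩ * (V ⟨x.shift ν, μ⟩ * (V₁ ⟨x.shift ν, μ⟩)⁻¹) * (V₁ ⟨x, ν⟩)⁻¹) *
      ((V₁ ⟨x, ν⟩ * V₁ ⟨x.shift ν, μ⟩ * ((V₁ ⟨x.shift μ, ν⟩)⁻¹ * V ⟨x.shift μ, ν⟩)⁻¹ * (V₁ ⟨x, ν⟩ * V₁ ⟨x.shift ν, μ⟩)⁻¹) *
        (GaugeField.plaqHol V₁ ⟨x, μ, ν, hμν⟩)⁻¹) *
      (V₁ ⟨x, ν⟩ * (V ⟨x.shift ν, μ⟩ * (V₁ ⟨x.shift ν, μ⟩)⁻¹) * (V₁ ⟨x, ν⟩)⁻¹)⁻¹) ≤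
      dist1 ((V₁ ⟨x.shift μ, ν⟩)⁻¹ * V ⟨x.shift μ, ν⟩) + dist1 (GaugeField.plaqHol V₁ ⟨x, μ, ν, hμν⟩) := by
    rw [GaugeGroup.dist1_conj]
    refine (GaugeGroup.dist1_mul_le _ _).trans (add_le_add ?_ ?_)
    · rw [GaugeGroup.dist1_conj, GaugeGroup.dist1_inv]
    · rw [GaugeGroup.dist1_inv]
  linarith [h1, h2, h3]

/-- ★★ **THE SAME WITH LETTERS**: if both plaquettes through `(x; μ, ν)` are `≤ ρ, ρ₁` and the two transverse relative chords are `≤ m`, the covariant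
same-direction oscillation of the relative chord is `≤ 2m + ρ + ρ₁` — `BKG + M`-class, no bond sizes. [cite: Balaban1985Averaging, (8)-(9) p.19] -/
theorem dist1_relChord_covariant_step_le' [GaugeGroup G] (V V₁ : GaugeField P j G) (x : Site P j) (μ ν : Fin P.d) (hμν : μ < ν) {ρ ρ₁ m : ℝ}
    (hρ : dist1 (GaugeField.plaqHol V ⟨x, μ, ν, hμν⟩) ≤ ρ) (hρ₁ : dist1 (GaugeField.plaqHol V₁ ⟨x, μ, ν, hμν⟩) ≤ ρ₁)
    (hm : dist1 (V ⟨x, ν⟩ * (V₁ ⟨x, ν⟩)⁻¹) ≤ m) (hm' : dist1 ((V₁ ⟨x.shift μ, ν⟩)⁻¹ * V ⟨x.shift μ, ν⟩) ≤ m) :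
    dist1 (V ⟨x, μ⟩ * (V₁ ⟨x, μ⟩)⁻¹ * (V₁ ⟨x, ν⟩ * (V ⟨x.shift ν, μ⟩ * (V₁ ⟨x.shift ν, μ⟩)⁻¹) * (V₁ ⟨x, ν⟩)⁻¹)⁻¹) ≤ 2 * m + ρ + ρ₁ := by
  have h := dist1_relChord_covariant_step_le V V₁ x μ ν hμν
  linarith

end Summit.QuantumFields.YangMills.Theorems.FluctuationComparisonRegPrIntLS2BetaRelChordCovariantStep
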